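/-
Copyright: the b2b-balaban T⁴-continuum CRUX team, row NE7b OWNER lineage `t4-ne7b-p1` (gen 110). Project licence.
-/
import Mathlib.Analysis.Calculus.ParametricIntegral
import Mathlib.Analysis.InnerProductSpace.Calculus
import Mathlib.Analysis.Calculus.Gradient.Basic
import Mathlib.Analysis.Calculus.ContDiff.Defs
import Mathlib.Analysis.SpecialFunctions.Log.Deriv
import Mathlib.Analysis.SpecialFunctions.ExpDeriv
import Mathlib.MeasureTheory.Measure.Haar.InnerProductSpace
import Mathlib.MeasureTheory.Function.LocallyIntegrable
import Mathlib.Topology.Algebra.Module.FiniteDimension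

/-!
# THE NEXT ACTION IS DIFFERENTIABLE EVERYWHERE, WITH NO SIDE LETTER: `ψ ↦ −log ∫_{K₂} e^{−V(φ) − G(ψ − Qφ)} dφ` has derivative
# `D(ψ₀) = (∫_{K₂} e^{−U(ψ₀,·)})⁻¹ • ∫_{K₂} e^{−U(ψ₀,φ)} • DG(ψ₀ − Qφ) dφ` — the tilted mean of the fluctuation weight's derivative — at EVERY
# `ψ₀`, for a bounded window of positive volume, `V` continuous, `G ∈ C¹` (row NE7b, node U5c; (R2′) family (2): the linear term of (ℓ1)∕(ℓ2))

Cell `pub-balaban`, sub-cell `t4`, spine estimate NE7b (`T4WeightBudget.RelWeightBound`; the cell's OWN estimate — NOT PRINTED in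
[Bałaban 1983–89], NOT PROVED).  Crux-route work under `Spine/NE7b/` by the row's OWNER; NOTHING of Bałaban's is named or asserted; no
`T4Continuum/Support` leaf typed; no `def`; zero `sorry`.  Imports: Mathlib only (independent of the hub's olean frontier).

WHY.  The step trilogy (30) `…FluctuationStepModulus` ∕ (31) `…FluctuationStepMarginal` ∕ (32) `…FluctuationStepGrowth` gives, for the
renormalisation-step exponent `U(ψ, φ) = V(φ) + G(ψ − Qφ)` on a window `K₂` of old fields, the next action
`V⁺ ψ = −log ∫_{K₂} e^{−U(ψ,φ)} dφ` PINCHED between a lower letter (modulus `aσ∕(σ + aκ²)`, secant currency — (31), via (26)) and an upper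
letter (growth `b`, with linear term `D(ψ₀)` = the tilted mean of `DG(ψ₀ − Q·)` — (32), via (29)).  The road's sockets want the lower
letter in FIRST-ORDER currency `V⁺ψ + DV⁺(ψ)(ψ' − ψ) + (λ∕2)‖ψ' − ψ‖² ≤ V⁺ψ'` ((26) §5 turns `StrongConvexOn` into it at any point where `V⁺`
HAS a derivative), and the two letters are a two-sided Taylor control only if the linear term of (32) IS `DV⁺(ψ₀)`.  (28)
`…LogConcaveMarginalDeriv` differentiates a fibre integral under domination letters quantified over ALL fibre points (`‖Vx‖ ≤ M`,
`V ≥ vmin` on `U × α`) — right for its measure-generic setting, but for the step on a WINDOW the Gaussian weight's derivative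
`DG(ψ − Qφ) = a(ψ − Qφ)` is unbounded in `φ` off the window, so those letters are not available as stated.  THIS FILE differentiates the
step integral directly under `volume.restrict K₂` (Mathlib's `hasFDerivAt_integral_of_dominated_of_fderiv_le`, domination a.e. ON the
window from compactness): NO side letter survives — `K₂` measurable, bounded, of positive volume, `V` continuous, `G ∈ C¹` suffice, at
EVERY base point.

WHAT IS PROVED ([folklore]):
* §1 `hasFDerivAt_stepSlice` (the slice `ψ ↦ V φ + G(ψ − Qφ)` has derivative `DG(ψ − Qφ)`), `exists_bound_stepDerivDensity` (a uniform
  bound of `e^{−U(ψ,φ)}‖DG(ψ − Qφ)‖` on `closedBall ψ₀ 1 × closure K₂` by compactness), **`hasFDerivAt_stepIntegral`**: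
  `HasFDerivAt (ψ ↦ ∫_{K₂} e^{−U(ψ,φ)} dφ) (−∫_{K₂} e^{−U(ψ₀,φ)} • DG(ψ₀ − Qφ) dφ) ψ₀`.
* §2 **`hasFDerivAt_neg_log_stepIntegral`** (`0 < volume K₂` in addition): `HasFDerivAt V⁺ ((∫_{K₂} e^{−U(ψ₀,·)})⁻¹ • ∫_{K₂} e^{−U(ψ₀,φ)} •
  DG(ψ₀ − Qφ) dφ) ψ₀` — EXACTLY the linear term `D(ψ₀)` of (32) `neg_log_stepIntegral_le_of_growth`; `hasGradientAt_neg_log_stepIntegral`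
  (gradient currency, `(toDual ℝ _).symm D`); `differentiable_neg_log_stepIntegral`.
* §3 the Gaussian weight `G = (a∕2)‖·‖²`: `hasFDerivAt_neg_log_gaussianStepIntegral` with `DG(w) = a • innerSL ℝ w` and no hypothesis on `G`.

NOT HERE (honest): the composition with (31)'s `StrongConvexOn` into the hypothesis-free first-order letter (one line with (26) §5 once (26),
(30), (31) have hub oleans — owed as (34)); which `V`, `G`, `Q`, `K₂` Bałaban's steps display ((A3) ∕ (A1c); NC-NE7b-α UNRULED); anything of
Bałaban's.  BY-NAME EFFECT ON THE WALL: NONE.  NE7b NOT PRINTED ∕ NOT PROVED; spine PROVED 0∕9; rung (B)+1 on a FINITE torus — NOT infinite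
volume, NOT the mass gap, NOT Clay.
HONEST DEPENDENCY: continuum YM on T⁴ ⇐ BetaPertH ∧ nine spine estimates (0/9 proved); BetaPertH ⇐ (D1) ∧ (D4) ∧ CAP+tail.
-/

set_option autoImplicit false

noncomputable section

open MeasureTheory Real Set Bornology Metric Filter Topology
open scoped RealInnerProductSpace

namespace Summit.QuantumFields.BalabanUV.T4Continuum.NE7b.FluctuationStepDeriv

variable {m n : ℕ}

/-! ## §1 Dominated differentiation of the step integral under `volume.restrict K₂` -/

/-- The slice `ψ ↦ V φ + G(ψ − Qφ)` of the step exponent has derivative `DG(ψ − Qφ)` at every `ψ` (`G` differentiable). [folklore] -/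
theorem hasFDerivAt_stepSlice {V : EuclideanSpace ℝ (Fin n) → ℝ} {G : EuclideanSpace ℝ (Fin m) → ℝ} (hGd : Differentiable ℝ G)
    (Q : EuclideanSpace ℝ (Fin n) →ₗ[ℝ] EuclideanSpace ℝ (Fin m)) (y : EuclideanSpace ℝ (Fin n)) (x : EuclideanSpace ℝ (Fin m)) :
    HasFDerivAt (fun x' : EuclideanSpace ℝ (Fin m) => V y + G (x' - Q y)) (fderiv ℝ G (x - Q y)) x := by
  have h1 : HasFDerivAt (fun x' : EuclideanSpace ℝ (Fin m) => x' - Q y) (ContinuousLinearMap.id ℝ _) x :=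
    (hasFDerivAt_id x).sub_const (Q y)
  have h2 := ((hGd (x - Q y)).hasFDerivAt.comp x h1).const_add (V y)
  rwa [ContinuousLinearMap.comp_id] at h2

/-- **A UNIFORM DOMINATION CONSTANT BY COMPACTNESS**: for `K₂` bounded, `V` continuous and `G ∈ C¹` there is `C` with
`‖e^{−(V φ + G(ψ − Qφ))} • DG(ψ − Qφ)‖ ≤ C` for all `ψ ∈ closedBall ψ₀ 1` and `φ ∈ K₂` (continuity on the compact
`closedBall ψ₀ 1 ×ˢ closure K₂`). [folklore] -/
theorem exists_bound_stepDerivDensity {K₂ : Set (EuclideanSpace ℝ (Fin n))} (hK₂b : IsBounded K₂)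
    {V : EuclideanSpace ℝ (Fin n) → ℝ} {G : EuclideanSpace ℝ (Fin m) → ℝ} (hVc : Continuous V) (hG1 : ContDiff ℝ 1 G)
    (Q : EuclideanSpace ℝ (Fin n) →ₗ[ℝ] EuclideanSpace ℝ (Fin m)) (x₀ : EuclideanSpace ℝ (Fin m)) :
    ∃ C : ℝ, ∀ x ∈ closedBall x₀ 1, ∀ y ∈ K₂, ‖exp (-(V y + G (x - Q y))) • fderiv ℝ G (x - Q y)‖ ≤ C := by
  have hGc : Continuous G := hG1.continuous
  have hdGc : Continuous (fderiv ℝ G) := (contDiff_one_iff_fderiv.1 hG1).2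
  have hQc : Continuous (Q : EuclideanSpace ℝ (Fin n) → EuclideanSpace ℝ (Fin m)) := Q.continuous_of_finiteDimensional
  have hdiff : Continuous fun p : EuclideanSpace ℝ (Fin m) × EuclideanSpace ℝ (Fin n) => p.1 - Q p.2 :=
    continuous_fst.sub (hQc.comp continuous_snd)
  have hf : Continuous fun p : EuclideanSpace ℝ (Fin m) × EuclideanSpace ℝ (Fin n) =>
      exp (-(V p.2 + G (p.1 - Q p.2))) • fderiv ℝ G (p.1 - Q p.2) :=
    (continuous_exp.comp ((hVc.comp continuous_snd).add (hGc.comp hdiff)).neg).smul (hdGc.comp hdiff)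
  have hK : IsCompact (closedBall x₀ (1 : ℝ) ×ˢ closure K₂) := (isCompact_closedBall x₀ 1).prod hK₂b.isCompact_closure
  obtain ⟨C, hC⟩ := hK.exists_bound_of_continuousOn hf.continuousOn
  exact ⟨C, fun x hx y hy => hC (x, y) ⟨hx, subset_closure hy⟩⟩

/-- **DIFFERENTIATION UNDER THE STEP INTEGRAL.**  `K₂ ⊆ ℝⁿ` measurable and bounded, `V` continuous, `G ∈ C¹`, `Q : ℝⁿ →ₗ ℝᵐ`.  Then at every
`ψ₀`: `HasFDerivAt (ψ ↦ ∫_{K₂} e^{−(V φ + G(ψ − Qφ))} dφ) (−∫_{K₂} e^{−(V φ + G(ψ₀ − Qφ))} • DG(ψ₀ − Qφ) dφ) ψ₀` (Mathlib's dominated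
differentiation on `volume.restrict K₂`, domination a.e. ON the window by `exists_bound_stepDerivDensity`). [folklore] -/
theorem hasFDerivAt_stepIntegral {K₂ : Set (EuclideanSpace ℝ (Fin n))} (hK₂m : MeasurableSet K₂) (hK₂b : IsBounded K₂)
    {V : EuclideanSpace ℝ (Fin n) → ℝ} {G : EuclideanSpace ℝ (Fin m) → ℝ} (hVc : Continuous V) (hG1 : ContDiff ℝ 1 G)
    (Q : EuclideanSpace ℝ (Fin n) →ₗ[ℝ] EuclideanSpace ℝ (Fin m)) (x₀ : EuclideanSpace ℝ (Fin m)) :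
    HasFDerivAt (fun x => ∫ y in K₂, exp (-(V y + G (x - Q y))))
      (-∫ y in K₂, exp (-(V y + G (x₀ - Q y))) • fderiv ℝ G (x₀ - Q y)) x₀ := by
  have hGc : Continuous G := hG1.continuous
  have hGd : Differentiable ℝ G := (contDiff_one_iff_fderiv.1 hG1).1
  have hdGc : Continuous (fderiv ℝ G) := (contDiff_one_iff_fderiv.1 hG1).2
  have hQc : Continuous (Q : EuclideanSpace ℝ (Fin n) → EuclideanSpace ℝ (Fin m)) := Q.continuous_of_finiteDimensional
  haveI : IsFiniteMeasure (volume.restrict K₂ : Measure (EuclideanSpace ℝ (Fin n))) :=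
    isFiniteMeasure_restrict.2 hK₂b.measure_lt_top.ne
  -- continuity of the integrand and of the derivative integrand in the fibre variable, at each base point
  have hFc : ∀ x : EuclideanSpace ℝ (Fin m), Continuous fun y : EuclideanSpace ℝ (Fin n) => exp (-(V y + G (x - Q y))) :=
    fun x => continuous_exp.comp (hVc.add (hGc.comp (continuous_const.sub hQc))).neg
  have hF'c : ∀ x : EuclideanSpace ℝ (Fin m), Continuous fun y : EuclideanSpace ℝ (Fin n) =>
      exp (-(V y + G (x - Q y))) • -fderiv ℝ G (x - Q y) :=
    fun x => (hFc x).smul (hdGc.comp (continuous_const.sub hQc)).neg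
  obtain ⟨C, hC⟩ := exists_bound_stepDerivDensity hK₂b hVc hG1 Q x₀
  have key := hasFDerivAt_integral_of_dominated_of_fderiv_le (μ := volume.restrict K₂) (x₀ := x₀)
    (F := fun x y => exp (-(V y + G (x - Q y)))) (F' := fun x y => exp (-(V y + G (x - Q y))) • -fderiv ℝ G (x - Q y))
    (bound := fun _ => C) (closedBall_mem_nhds x₀ one_pos)
    (Eventually.of_forall fun x => (hFc x).aestronglyMeasurable)
    (((hFc x₀).continuousOn.integrableOn_compact hK₂b.isCompact_closure).mono_set subset_closure)
    (hF'c x₀).aestronglyMeasurable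
    (ae_restrict_of_forall_mem hK₂m fun y hy x hx => by
      rw [smul_neg, norm_neg]
      exact hC x hx y hy)
    (integrable_const C)
    (ae_restrict_of_forall_mem hK₂m fun y _ x _ => ((hasFDerivAt_stepSlice (V := V) hGd Q y x).neg).exp)
  have e : ∫ y in K₂, exp (-(V y + G (x₀ - Q y))) • -fderiv ℝ G (x₀ - Q y) =
      -∫ y in K₂, exp (-(V y + G (x₀ - Q y))) • fderiv ℝ G (x₀ - Q y) := by
    rw [← integral_neg]
    exact integral_congr_ae (Eventually.of_forall fun y => smul_neg _ _)
  rw [e] at key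
  exact key

/-! ## §2 The next action: derivative = the tilted mean of `DG(ψ₀ − Q·)` -/

/-- **THE NEXT ACTION IS DIFFERENTIABLE AT EVERY POINT, NO SIDE LETTER.**  `K₂ ⊆ ℝⁿ` measurable, bounded, of positive volume; `V`
continuous; `G ∈ C¹`; `Q : ℝⁿ →ₗ ℝᵐ`.  Then `V⁺ = ψ ↦ −log ∫_{K₂} e^{−(V φ + G(ψ − Qφ))} dφ` has, at every `ψ₀`, the Fréchet derivative
`D(ψ₀) = (∫_{K₂} e^{−U(ψ₀,·)})⁻¹ • ∫_{K₂} e^{−U(ψ₀,φ)} • DG(ψ₀ − Qφ) dφ` — the mean of the slice derivatives under the tilted fibre law at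
`ψ₀`; EXACTLY the linear term of (32) `…FluctuationStepGrowth.neg_log_stepIntegral_le_of_growth`. [folklore] -/
theorem hasFDerivAt_neg_log_stepIntegral {K₂ : Set (EuclideanSpace ℝ (Fin n))} (hK₂m : MeasurableSet K₂) (hK₂b : IsBounded K₂)
    (hK₂v : 0 < volume K₂) {V : EuclideanSpace ℝ (Fin n) → ℝ} {G : EuclideanSpace ℝ (Fin m) → ℝ} (hVc : Continuous V)
    (hG1 : ContDiff ℝ 1 G) (Q : EuclideanSpace ℝ (Fin n) →ₗ[ℝ] EuclideanSpace ℝ (Fin m)) (x₀ : EuclideanSpace ℝ (Fin m)) :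
    HasFDerivAt (fun x => -log (∫ y in K₂, exp (-(V y + G (x - Q y)))))
      ((∫ y in K₂, exp (-(V y + G (x₀ - Q y))))⁻¹ • ∫ y in K₂, exp (-(V y + G (x₀ - Q y))) • fderiv ℝ G (x₀ - Q y)) x₀ := by
  have hGc : Continuous G := hG1.continuous
  have hQc : Continuous (Q : EuclideanSpace ℝ (Fin n) → EuclideanSpace ℝ (Fin m)) := Q.continuous_of_finiteDimensional
  have hFc : Continuous fun y : EuclideanSpace ℝ (Fin n) => exp (-(V y + G (x₀ - Q y))) :=
    continuous_exp.comp (hVc.add (hGc.comp (continuous_const.sub hQc))).neg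
  have hZ : 0 < ∫ y in K₂, exp (-(V y + G (x₀ - Q y))) := by
    haveI : NeZero (volume.restrict K₂ : Measure (EuclideanSpace ℝ (Fin n))) :=
      ⟨fun h => hK₂v.ne' (Measure.restrict_eq_zero.1 h)⟩
    exact integral_exp_pos ((hFc.continuousOn.integrableOn_compact hK₂b.isCompact_closure).mono_set subset_closure)
  have h := ((hasFDerivAt_stepIntegral hK₂m hK₂b hVc hG1 Q x₀).log hZ.ne').neg
  rw [smul_neg, neg_neg] at h
  exact h

/-- **GRADIENT CURRENCY** (the sockets' `EuclideanSpace ℝ (Fin m)`): `V⁺` has gradient `(toDual ℝ _).symm D(ψ₀)` at every `ψ₀`; in particular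
(26) `…LogConcaveMarginal.firstOrder_of_strongConvexOn_hasGradientAt` applies at EVERY base point once `StrongConvexOn` is known ((31)). [folklore] -/
theorem hasGradientAt_neg_log_stepIntegral {K₂ : Set (EuclideanSpace ℝ (Fin n))} (hK₂m : MeasurableSet K₂) (hK₂b : IsBounded K₂)
    (hK₂v : 0 < volume K₂) {V : EuclideanSpace ℝ (Fin n) → ℝ} {G : EuclideanSpace ℝ (Fin m) → ℝ} (hVc : Continuous V)
    (hG1 : ContDiff ℝ 1 G) (Q : EuclideanSpace ℝ (Fin n) →ₗ[ℝ] EuclideanSpace ℝ (Fin m)) (x₀ : EuclideanSpace ℝ (Fin m)) :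
    HasGradientAt (fun x => -log (∫ y in K₂, exp (-(V y + G (x - Q y)))))
      ((InnerProductSpace.toDual ℝ (EuclideanSpace ℝ (Fin m))).symm
        ((∫ y in K₂, exp (-(V y + G (x₀ - Q y))))⁻¹ • ∫ y in K₂, exp (-(V y + G (x₀ - Q y))) • fderiv ℝ G (x₀ - Q y))) x₀ := by
  rw [hasGradientAt_iff_hasFDerivAt, LinearIsometryEquiv.apply_symm_apply]
  exact hasFDerivAt_neg_log_stepIntegral hK₂m hK₂b hK₂v hVc hG1 Q x₀

/-- Hence the next action is differentiable on all of `ℝᵐ`. [folklore] -/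
theorem differentiable_neg_log_stepIntegral {K₂ : Set (EuclideanSpace ℝ (Fin n))} (hK₂m : MeasurableSet K₂) (hK₂b : IsBounded K₂)
    (hK₂v : 0 < volume K₂) {V : EuclideanSpace ℝ (Fin n) → ℝ} {G : EuclideanSpace ℝ (Fin m) → ℝ} (hVc : Continuous V)
    (hG1 : ContDiff ℝ 1 G) (Q : EuclideanSpace ℝ (Fin n) →ₗ[ℝ] EuclideanSpace ℝ (Fin m)) :
    Differentiable ℝ fun x => -log (∫ y in K₂, exp (-(V y + G (x - Q y)))) :=
  fun x₀ => (hasFDerivAt_neg_log_stepIntegral hK₂m hK₂b hK₂v hVc hG1 Q x₀).differentiableAt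

/-! ## §3 The Gaussian fluctuation weight -/

section Gaussian

/-- `a • innerSL ℝ w` is the derivative of `(a∕2)‖·‖²` at `w` (stated here to keep the file Mathlib-only; the same lemma is
`…FluctuationStepGrowth.hasFDerivAt_gaussian`). [folklore] -/
theorem hasFDerivAt_halfSqNorm (a : ℝ) (w : EuclideanSpace ℝ (Fin m)) :
    HasFDerivAt (fun v : EuclideanSpace ℝ (Fin m) => a / 2 * ‖v‖ ^ 2) (a • innerSL ℝ w) w := by
  refine (((hasStrictFDerivAt_norm_sq w).hasFDerivAt).const_mul (a / 2)).congr_fderiv ?_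
  ext v
  simp only [smul_apply, smul_eq_mul, nsmul_eq_mul, Nat.cast_ofNat, innerSL_apply_apply]
  ring

/-- **THE GAUSSIAN STEP's NEXT ACTION IS `C¹` WITH THE DISPLAYED DERIVATIVE**: `K₂` measurable, bounded, of positive volume, `V` continuous,
`Q : ℝⁿ →ₗ ℝᵐ`, `a : ℝ` ⟹ at every `ψ₀`, `ψ ↦ −log ∫_{K₂} e^{−(V φ + (a∕2)‖ψ − Qφ‖²)} dφ` has derivative
`(∫_{K₂} e^{−U(ψ₀,·)})⁻¹ • ∫_{K₂} e^{−U(ψ₀,φ)} • (a • innerSL ℝ (ψ₀ − Qφ)) dφ` (`= v ↦ a⟪ψ₀ − Q φ̄, v⟫`, `φ̄` the tilted mean of the old field).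
[folklore] -/
theorem hasFDerivAt_neg_log_gaussianStepIntegral {K₂ : Set (EuclideanSpace ℝ (Fin n))} (hK₂m : MeasurableSet K₂)
    (hK₂b : IsBounded K₂) (hK₂v : 0 < volume K₂) {V : EuclideanSpace ℝ (Fin n) → ℝ} (hVc : Continuous V) (a : ℝ)
    (Q : EuclideanSpace ℝ (Fin n) →ₗ[ℝ] EuclideanSpace ℝ (Fin m)) (x₀ : EuclideanSpace ℝ (Fin m)) :
    HasFDerivAt (fun x => -log (∫ y in K₂, exp (-(V y + a / 2 * ‖x - Q y‖ ^ 2))))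
      ((∫ y in K₂, exp (-(V y + a / 2 * ‖x₀ - Q y‖ ^ 2)))⁻¹ •
        ∫ y in K₂, exp (-(V y + a / 2 * ‖x₀ - Q y‖ ^ 2)) • (a • innerSL ℝ (x₀ - Q y))) x₀ := by
  have hG1 : ContDiff ℝ 1 fun v : EuclideanSpace ℝ (Fin m) => a / 2 * ‖v‖ ^ 2 :=
    (contDiff_const.mul (contDiff_norm_sq ℝ)).of_le le_top
  have h := hasFDerivAt_neg_log_stepIntegral (G := fun v : EuclideanSpace ℝ (Fin m) => a / 2 * ‖v‖ ^ 2) hK₂m hK₂b hK₂v hVc hG1 Q x₀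
  have e : ∀ w : EuclideanSpace ℝ (Fin m), fderiv ℝ (fun v : EuclideanSpace ℝ (Fin m) => a / 2 * ‖v‖ ^ 2) w = a • innerSL ℝ w :=
    fun w => (hasFDerivAt_halfSqNorm a w).fderiv
  simp only [e] at h
  exact h

end Gaussian

/-! ## §4 Sanity (decided toy) -/

/-- Toy: the tilted-mean derivative formula at the numbers of a symmetric window — if the tilted mean of the old field is `0` (even window,
even `V`, `ψ₀ = 0`), the Gaussian step's derivative at `ψ₀ = 0` is `a⟪0 − Q 0, ·⟫ = 0`: the next action is critical at the origin, the
input of the road's critical-centre socket (21). Here only the arithmetic shape `a * (0 - 0) = 0` is decided. -/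
example (a : ℝ) : a * ((0 : ℝ) - 0) = 0 := by norm_num

end Summit.QuantumFields.BalabanUV.T4Continuum.NE7b.FluctuationStepDeriv
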